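import Summits.QuantumFields.YangMills.Theorems.BalabanUVNodesN09LiftInvariance29AtRecord
import Summits.QuantumFields.YangMills.Theorems.BalabanUVNodesN09OneDefectAveraging

/-!
# NODE N09 — THE JUNK WITNESS: at the bare-choice record the (M1) binder `h09inv` of 17H is FALSE in print's regime (`0 ≤ a₀`, `217·a₀ ≤ 2`,
# `0 < ε₂₉ ≤ 2`): `V = 1[b₀(c⋆) ↦ g]` averages to the one-defect coarse field, whose plaquette at `c⋆` is far, so `V̄` is UNSOLVABLE ([B7] Prop 1);
# `V` lies in the `ε₂₉`-tube around `1` off the `b₀`-bonds and `v = 1[0 ↦ g]` moves one non-`b₀` crossing bond out of it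

TRACK A (YM-PLAN §2d, node N09 of 28), seat `pub-ymgap-dag-n09-w2` (D-0149 width seat 2∕4; W-SEAT-START-LIST §n09 item 2), FILE 2b.  Key of record: K1⁷
`StabilityBAtRecordR13SepCoPH` = stmt-QuantumFields-20542; `--supports` it as a helper (Summits lane).  [I] = [Balaban1987RG1] (CMP 109), [B7] =
[Balaban1985Averaging] (CMP 98), [B11] = [Balaban1985Variational] (CMP 102).

WHY.  FILE 1 (`…BalabanUVNodesN09LiftInvariance29AtRecord`, p583470) typed 17H's located binder (M1) `h09inv` at the bare-choice record and proved the
abstract obstruction `not_liftInvariant_chiFix29OfRecord_of_junkWitness`; FILE 2a (`…BalabanUVNodesN09OneDefectAveraging`) computed the (0.4) average of the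
one-defect field.  THIS FILE assembles the witness at step `k = 0` of every run of length `K ≥ 1`:
* §4 UNSOLVABILITY: by ym3's crude [B7] Prop 1 (`BlockAveragingPlaquetteBound.plaqSmall_blockAvg_expMeanLogSU`; at `d = 4`, radius `a·L⁻²`: threshold `217·a`,
  guard `9·a`) NO regular `U₀ ∈ bgReg K 1 a` averages to a coarse field with a plaquette at distance `≥ 217·a` from `1`: `¬ UkExists K 1 a W`
  (`not_ukExists_one_of_far_plaquette`).
* §5 ★ THE WITNESS (`SU(N)`; `g, g′` with `dist1 g ≥ max(δ_N, 217·ν.εreg)`, `dist1 g′ ≥ ε₁ > 0`; `0 ≤ ν.εreg`, `9·ν.εreg < δ_N`): `V = 1[b₀(⟨0, e₀⟩) ↦ g]`,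
  `v = 1[0 ↦ g′]`, moved bond `b♯ = ⟨blockSite 0 (L−1, 0, 0, 0), e₀⟩` (crossing, off every axis) ⇒ **`¬ LiftInvariant (chiFix29OfRecord F N ν ε₁ K 0)`**
  (`not_liftInvariant_chiFix29OfRecord_zero`).
* §6 ★★ `SU(2)`, `g = g′ = expPoint(π e₀)` (`dist1 = 2`), `δ_{SU(2)} = 1∕3` (inline): for `0 ≤ a₀`, `217·a₀ ≤ 2`, `0 < ε₂₉ ≤ 2`,
  **`¬ ∀ P, ∀ j′ < P.K, LiftInvariant (chiβOfRecord₁₃ F 2 θ₁₅ᶜᶜᴹᵂ(j; γ; ε₀, ε₂₉; B₃, B₃′, a₀, a₁) P.K (gOfRecord₁₃ …) j′)`** (`not_h09inv_theta13OfThm1CCMW`): the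
  hypothesis `h09inv` of all five theorems of `Summits/…/BalabanUVNodesN24AtThm1CCMWDoorOfStepTokensSignFreeN09Located` (p575941) is UNSATISFIABLE at the V17
  door in that regime, so they are VACUOUS there (A6) until the record's selection `Uk` is made covariant (FILE 1 §1) AND (M1) is re-typed on the solvable
  set ∕ a small-field domain (the junk corner `U_{k+1} := 1` lies outside every such domain).

HONEST FRAMING: a kernel REFUTATION of ONE displayed hypothesis of a door theorem in an explicit regime, from NODE 00's definitions of record and tree theorems
([B7] Prop 1 crude form = ym3-torus' theorem, by name); nothing of Bałaban's asserted; the CRUX K1⁷ does not mention (M1) and is NOT refuted; N09 NOT discharged;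
K0⁷ ∕ K1⁷ OPEN; counts unmoved (typed 28∕28 · discharged 5∕27); R4 is the conditional finite-𝕋⁴ rung `BalabanLadder.UV` only — NOT continuum ∕ ℝ⁴ ∕ OS ∕ mass
gap ∕ Clay.  THEOREMS ONLY (0 `def`, 0 `sorry`, 0 `instance`, 0 `notation`), standard axioms.
-/

noncomputable section

namespace Summit.QuantumFields.YangMills.BalabanUVNodes.N09LiftInvariance29JunkWitness

open Literature.MathematicalPhysics.QuantumFieldTheory.Balaban1983to89
open Literature.MathematicalPhysics.QuantumFieldTheory.Balaban1983to89.Node00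
open Literature.MathematicalPhysics.QuantumFieldTheory.BalabanImbrieJaffe1984to88.BIJ85CurlQsstar (shift_blockSite_of_eq)
open scoped Matrix.Norms.L2Operator
open B12RTGaugeInvariance254 (LiftInvariant liftTransf)
open AveragingRT (axialAvg lineSite line lineSite_eq_lo offLo blockSite_inj half_lt two_mul_half_add_one)
open BlockAveraging (Idx off loopHol Small corr avgFun blockAvg)
open BlockAveragingHaarAC (centralBond IsCentral)
open ExpMeanLog (expMeanLogSU deltaSU deltaSU_pos)
open Summit.QuantumFields.YangMills.BalabanUVNodes.N09LiftInvariance29AtRecord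
  (not_liftInvariant_chiFix29OfRecord_of_junkWitness not_h09inv_theta13OfThm1CCMW_of_junkWitness)
open Summit.QuantumFields.YangMills.BalabanUVNodes.N09OneDefectAveraging
  (avOfRecord_avg_one avgFun_expMeanLogSU_update_one plaqHol_update_one shift_ne_self)
open GaugeField (gaugeAct plaqHol)

variable {F : T4Continuum.T4Family} {N : ℕ} [NeZero N]


/-! ## §4. Unsolvability of the level-1 problem of record over a coarse field with a far plaquette -/

/-- `(F.P K).d = 4`, `(F.P K).L = F.L`, `(F.P K).m = F.m`, `(F.P K).K = K` (all `rfl`). [cite: Balaban1987RG1, (0.1) p.251 (bookkeeping)] -/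
theorem params_fields (K : ℕ) : (F.P K).d = 4 ∧ (F.P K).L = F.L ∧ (F.P K).m = F.m ∧ (F.P K).K = K := ⟨rfl, rfl, rfl, rfl⟩

/-- The [B7] Prop 1 constants at `d = 4`, radius `a·η₁² = a·L⁻²`: threshold `(L² + 6(6L)²)·(a L⁻²) = 217·a`, guard `((6L)²/4)·(a L⁻²) = 9·a`.
[cite: Balaban1985Averaging, Prop. 1 (51) p.26 (arithmetic)] -/
theorem prop1_constants (K : ℕ) (a : ℝ) :
    (((F.P K).L : ℝ) ^ 2 + 6 * ((((F.P K).d + 2) * (F.P K).L : ℕ) : ℝ) ^ 2) * (a * (F.P K).eta 1 ^ 2) = 217 * a ∧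
      ((((F.P K).d + 2) * (F.P K).L : ℕ) : ℝ) ^ 2 / 4 * (a * (F.P K).eta 1 ^ 2) = 9 * a := by
  have hL : ((F.P K).L : ℝ) ≠ 0 := Nat.cast_ne_zero.2 (F.P K).L_pos.ne'
  rw [show (F.P K).d = 4 from rfl]
  unfold Params.eta
  push_cast
  constructor
  · field_simp
    ring
  · field_simp
    ring

/-- **NO REGULAR FINE FIELD AVERAGES TO A COARSE FIELD WITH A FAR PLAQUETTE** — [B7] Prop 1 (crude form, ym3-torus' `plaqSmall_blockAvg_expMeanLogSU`) read
contrapositively at the record: if some plaquette of `W : T^{(1)}` is at distance `≥ 217·a` from `1` and `9a < δ_N`, `0 ≤ a`, then the level-1 problem (0.21) of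
record at `W` within `bgReg K 1 a = {|U₀(∂p) − 1| < a·L⁻²}` has NO minimiser (indeed no admissible competitor): `¬ UkExists K 1 a W`.
[cite: Balaban1985Averaging, Prop. 1 (51) p.26; Balaban1987RG1, (0.21) p.256 and (1.2) p.260] -/
theorem not_ukExists_one_of_far_plaquette {K : ℕ} {a : ℝ} (ha : 0 ≤ a) (hguard : 9 * a < deltaSU (Fin N)) {W : GaugeField (F.P K) 1 (SU N)}
    (hfar : ∃ p : Plaq (F.P K) 1, 217 * a ≤ dist1 (plaqHol W p)) : ¬ UkExists F N K 1 a W := by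
  rintro ⟨U₀, hiter, hreg, -⟩
  obtain ⟨p, hp⟩ := hfar
  have hj : 0 + 1 ≤ (F.P K).m + (F.P K).K := by show 1 ≤ F.m + K; have := F.hm; omega
  obtain ⟨hC, hG⟩ := prop1_constants (F := F) K a
  have ha' : 0 ≤ a * (F.P K).eta 1 ^ 2 := mul_nonneg ha (sq_nonneg _)
  have hU : PlaqSmall (a * (F.P K).eta 1 ^ 2) U₀ := (mem_bgReg_iff F N K 1 a U₀).1 hreg
  have hsmall := BlockAveragingPlaquetteBound.plaqSmall_blockAvg_expMeanLogSU (n := Fin N) hj ha' hU (by rw [hG]; exact hguard)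
  rw [hC] at hsmall
  have hW : (blockAvg (expMeanLogSU (n := Fin N))).avg U₀ = W := hiter
  rw [hW] at hsmall
  exact absurd (hsmall p) (not_lt.2 hp)

/-! ## §5. The junk witness at step 0 and the refutation of `h09inv` -/

section Witness

variable (K : ℕ)

/-- The distinguished coarse bond `c⋆ = ⟨0, e₀⟩` of `T^{(1)}` has a transverse direction `e₁` (`d = 4`). [cite: Balaban1987RG1, (0.1) p.251 (bookkeeping)] -/
theorem dir_lt_one : (⟨(0 : Site (F.P K) 1), ⟨0, (F.P K).hd⟩⟩ : PBond (F.P K) 1).dir < ⟨1, by show 1 < 4; norm_num⟩ :=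
  Fin.mk_lt_mk.2 Nat.zero_lt_one

/-- The moved bond `b♯ = ⟨blockSite 0 r♯, e₀⟩`, `r♯ = (L−1, 0, 0, 0)`: it issues from the block of `0` … [cite: Balaban1987RG1, (0.3) p.252 (bookkeeping)] -/
theorem blockOf_src_bSharp (hK : 0 + 1 ≤ (F.P K).m + (F.P K).K) :
    blockOf (Site.blockSite (0 : Site (F.P K) 1)
      (fun ν : Fin (F.P K).d => if ν = ⟨0, (F.P K).hd⟩ then ⟨(F.P K).L - 1, by have := (F.P K).L_pos; omega⟩ else ⟨0, (F.P K).L_pos⟩)) =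
      (0 : Site (F.P K) 1) :=
  Site.blockOf_blockSite hK _ _

/-- … and ends in the NEXT block `0 + e₀ ≠ 0` (it is a crossing bond). [cite: Balaban1987RG1, (0.3) p.252 (bookkeeping)] -/
theorem blockOf_tgt_bSharp (hK : 0 + 1 ≤ (F.P K).m + (F.P K).K) :
    blockOf ((Site.blockSite (0 : Site (F.P K) 1)
      (fun ν : Fin (F.P K).d => if ν = ⟨0, (F.P K).hd⟩ then ⟨(F.P K).L - 1, by have := (F.P K).L_pos; omega⟩ else ⟨0, (F.P K).L_pos⟩)).shift
        ⟨0, (F.P K).hd⟩) = (0 : Site (F.P K) 1).shift ⟨0, (F.P K).hd⟩ := by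
  rw [shift_blockSite_of_eq hK]
  · exact Site.blockOf_blockSite hK _ _
  · simp only [if_true]
    have := (F.P K).L_pos
    omega

/-- `b♯` is not a distinguished bond `b₀(c)` (its `e₁`-offset in the block is `0`, not `(L−1)/2 ≥ 1`). [cite: Balaban1987RG1, (2.9) p.266 and p.267 (bookkeeping)] -/
theorem not_isB0_bSharp (hK : 0 + 1 ≤ (F.P K).m + (F.P K).K) :
    ¬ IsB0 (F := F) (⟨Site.blockSite (0 : Site (F.P K) 1)
      (fun ν : Fin (F.P K).d => if ν = ⟨0, (F.P K).hd⟩ then ⟨(F.P K).L - 1, by have := (F.P K).L_pos; omega⟩ else ⟨0, (F.P K).L_pos⟩),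
      ⟨0, (F.P K).hd⟩⟩ : PBond (F.P K) 0) := by
  rintro ⟨c, hc⟩
  have hL := (F.P K).hL.2
  obtain ⟨k, hk⟩ := (F.P K).hL.1
  have hdir : c.dir = ⟨0, (F.P K).hd⟩ := congrArg PBond.dir hc
  have hsrc := congrArg PBond.src hc
  change lineSite c (((F.P K).L - 1) / 2) = _ at hsrc
  rw [lineSite_eq_lo hK c le_rfl] at hsrc
  have h1 := congrArg Fin.val (congrFun (blockSite_inj hK hsrc).2 ⟨1, by show 1 < 4; norm_num⟩)
  have hne' : (⟨1, by show 1 < 4; norm_num⟩ : Fin (F.P K).d) ≠ ⟨0, (F.P K).hd⟩ := ne_of_apply_ne Fin.val (by norm_num)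
  have hne : (⟨1, by show 1 < 4; norm_num⟩ : Fin (F.P K).d) ≠ c.dir := by rw [hdir]; exact hne'
  simp only [offLo, if_neg hne, if_neg hne', Fin.val_mk] at h1
  omega

/-- The distinguished bonds ARE the central bonds: `b₀(c) = centralBond c` (`rfl`), so a non-`b₀` bond is not `centralBond c⋆`.
[cite: Balaban1987RG1, (2.9) p.266 (bookkeeping)] -/
theorem ne_centralBond_of_not_isB0 {K k : ℕ} {b : PBond (F.P K) k} (hb : ¬ IsB0 (F := F) b) (c : PBond (F.P K) (k + 1)) : b ≠ centralBond c :=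
  fun h => hb ⟨c, h.symm⟩

/-- **★ THE JUNK WITNESS AT STEP 0 ⇒ `¬ LiftInvariant χ^{(2.9)}_0`** on `SU(N)`: for numerics `ν` with `0 ≤ ν.εreg`, `9·ν.εreg < δ_N`, and group elements `g, g′`
with `dist1 g ≥ max(δ_N, 217·ν.εreg)`, `dist1 g′ ≥ ε₁ > 0`, the (2.9) cut-off of record at step `0` of the `K`-th approximation (`K ≥ 1`) is NOT block-lift
invariant — the field `V = 1[b₀(c⋆) ↦ g]` has an UNSOLVABLE average (§2–§4), lies in the `ε₁`-tube around `1 = M⁰(1)` off the `b₀` bonds, and `v = 1[0 ↦ g′]`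
moves the crossing bond `b♯` out of the tube (FILE 1 `not_liftInvariant_chiFix29OfRecord_of_junkWitness`).
[cite: Balaban1987RG1, (2.9) p.266 and (0.21) p.256 (typing convention); Balaban1985Averaging, Prop. 1 (51) p.26] -/
theorem not_liftInvariant_chiFix29OfRecord_zero (hK : 1 ≤ K) (ν : Stage7Numerics) (hreg : 0 ≤ ν.εreg) (hguard : 9 * ν.εreg < deltaSU (Fin N))
    {g g' : SU N} (hgδ : deltaSU (Fin N) ≤ dist1 g) (hgfar : 217 * ν.εreg ≤ dist1 g) {ε₁ : ℝ} (hε : 0 < ε₁) (hg' : ε₁ ≤ dist1 g') :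
    ¬ LiftInvariant (chiFix29OfRecord F N ν ε₁ K 0) := by
  have hj : 0 + 1 ≤ (F.P K).m + (F.P K).K := by show 1 ≤ F.m + K; omega
  have hd : 2 ≤ (F.P K).d := by show 2 ≤ 4; norm_num
  -- the distinguished coarse bond, the defect field, the coarse transformation, the moved bond
  let cs : PBond (F.P K) 1 := ⟨0, ⟨0, (F.P K).hd⟩⟩
  let V : GaugeField (F.P K) 0 (SU N) := Function.update 1 (centralBond cs) g
  let v : GaugeTransf (F.P K) 1 (SU N) := Function.update (fun _ => 1) (0 : Site (F.P K) 1) g'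
  let rs : Fin (F.P K).d → Fin (F.P K).L :=
    fun μ => if μ = ⟨0, (F.P K).hd⟩ then ⟨(F.P K).L - 1, by have := (F.P K).L_pos; omega⟩ else ⟨0, (F.P K).L_pos⟩
  let bs : PBond (F.P K) 0 := ⟨Site.blockSite (0 : Site (F.P K) 1) rs, ⟨0, (F.P K).hd⟩⟩
  have havg : (avOfRecord F N K 0).avg V = Function.update (1 : GaugeField (F.P K) 1 (SU N)) cs g := by
    rw [avOfRecord_avg]
    exact avgFun_expMeanLogSU_update_one hj hd cs hgδ
  refine not_liftInvariant_chiFix29OfRecord_of_junkWitness hj V v ?_ ?_ ?_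
  · -- unsolvable average
    rw [havg]
    exact not_ukExists_one_of_far_plaquette hreg hguard
      ⟨⟨cs.src, cs.dir, ⟨1, by show 1 < 4; norm_num⟩, dir_lt_one K⟩, by rw [plaqHol_update_one cs (dir_lt_one K) g]; exact hgfar⟩
  · -- inside the tube off the distinguished bonds
    intro b hb
    have hVb : V b = 1 := by
      show Function.update (1 : GaugeField (F.P K) 0 (SU N)) (centralBond cs) g b = 1
      rw [Function.update_of_ne (ne_centralBond_of_not_isB0 hb cs)]
      rfl
    rw [hVb]
    show dist1 ((1 : SU N)⁻¹ * 1) < ε₁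
    rw [inv_one, mul_one, GaugeGroup.dist1_one]
    exact hε
  · -- the crossing bond `b♯` is moved out of the tube
    refine ⟨bs, not_isB0_bSharp K hj, ?_⟩
    have hVb : V bs = 1 := by
      show Function.update (1 : GaugeField (F.P K) 0 (SU N)) (centralBond cs) g bs = 1
      rw [Function.update_of_ne (ne_centralBond_of_not_isB0 (not_isB0_bSharp K hj) cs)]
      rfl
    have hsrc : v (blockOf bs.src) = g' := by
      show Function.update (fun _ => (1 : SU N)) (0 : Site (F.P K) 1) g' (blockOf (Site.blockSite (0 : Site (F.P K) 1) rs)) = g'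
      rw [blockOf_src_bSharp K hj, Function.update_self]
    have htgt : v (blockOf bs.tgt) = 1 := by
      show Function.update (fun _ => (1 : SU N)) (0 : Site (F.P K) 1) g' (blockOf ((Site.blockSite (0 : Site (F.P K) 1) rs).shift ⟨0, (F.P K).hd⟩)) = 1
      rw [blockOf_tgt_bSharp K hj, Function.update_of_ne (shift_ne_self _ _)]
    rw [hVb, hsrc, htgt]
    show ε₁ ≤ dist1 ((1 : SU N)⁻¹ * (g' * 1 * (1 : SU N)⁻¹))
    rw [inv_one, one_mul, mul_one, mul_one]
    exact hg'

end Witness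

/-! ## §6. `SU(2)`: the explicit far element and the refutation of 17H's `h09inv` at the V17 door -/

section SU2

open T4HaarSU2ExpChart (expPoint)

/-- An element of `SU(2)` at distance `2` from `1`: `exp(π·ι e₀) = −1` (`dist1 (expPoint x) = 2|sin(‖x‖/2)|`). [folklore] -/
theorem dist1_expPoint_single_pi : dist1 (expPoint (EuclideanSpace.single (0 : Fin 3) Real.pi)) = 2 := by
  rw [T4ExpWindowSmallField.dist1_expPoint_eq, show EuclideanSpace.single (0 : Fin 3) Real.pi = PiLp.single 2 (0 : Fin 3) Real.pi from rfl,
    PiLp.norm_single, Real.norm_eq_abs, abs_of_pos Real.pi_pos, Real.sin_pi_div_two, abs_one, mul_one]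

/-- **★★ `¬ LiftInvariant χ^{(2.9)}_0` ON `SU(2)` IN PRINT's REGIME**: `0 ≤ ν.εreg`, `217·ν.εreg ≤ 2`, `0 < ε₁ ≤ 2`, every run length `K ≥ 1`.
[cite: Balaban1987RG1, (2.9) p.266 and (0.21) p.256 (typing convention); Balaban1985Averaging, Prop. 1 (51) p.26] -/
theorem not_liftInvariant_chiFix29OfRecord_zero_SU2 (K : ℕ) (hK : 1 ≤ K) (ν : Stage7Numerics) (hreg : 0 ≤ ν.εreg) (hreg' : 217 * ν.εreg ≤ 2)
    {ε₁ : ℝ} (hε : 0 < ε₁) (hε' : ε₁ ≤ 2) : ¬ LiftInvariant (chiFix29OfRecord F 2 ν ε₁ K 0) := by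
  have h2 := dist1_expPoint_single_pi
  -- `δ_{SU(2)} = min(1/3, π/2) = 1/3` (ym3 `…AvgActionDefect.deltaSU_fin_two`; recomputed inline to keep this file's imports small)
  have hδ : deltaSU (Fin 2) = 1 / 3 := by
    rw [deltaSU, Fintype.card_fin, min_eq_left]
    have := Real.pi_gt_three
    push_cast
    linarith
  refine not_liftInvariant_chiFix29OfRecord_zero K hK ν hreg ?_ (g := expPoint (EuclideanSpace.single (0 : Fin 3) Real.pi))
    (g' := expPoint (EuclideanSpace.single (0 : Fin 3) Real.pi)) ?_ ?_ hε ?_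
  · rw [hδ]; linarith
  · rw [hδ, h2]; norm_num
  · rw [h2]; exact hreg'
  · rw [h2]; exact hε'

/-- **★★ THE JUNCTION's (M1) AT ANY STAGE-13 PARAMETER ON `SU(2)`**: for every `θ : Stage13Params F 2` with `0 ≤ θ.ν.εreg`, `217·θ.ν.εreg ≤ 2`, `0 < θ.ε₂₉ ≤ 2`,
every run length `K ≥ 1` and every coupling sequence, `¬ ∀ j < K, LiftInvariant (chiβOfRecord₁₃ F 2 θ K g j)` — the displayed `hχinv` of dag-n24-c's junction
`B12NodeKnitRecord13SepCoPH` §2–§5 and of every door keyed on it (17H, 20H) is unsatisfiable in that regime. [cite: Balaban1987RG1, (2.9) p.266 and (0.21) p.256 (typing convention); Balaban1985Averaging, Prop. 1 (51) p.26] -/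
theorem not_hχinv_stage13_SU2 (θ : Stage13Params F 2) (hreg : 0 ≤ θ.ν.εreg) (hreg' : 217 * θ.ν.εreg ≤ 2) (hε : 0 < θ.ε₂₉) (hε' : θ.ε₂₉ ≤ 2)
    {K : ℕ} (hK : 1 ≤ K) (g : ℕ → ℝ) : ¬ ∀ j < K, LiftInvariant (chiβOfRecord₁₃ F 2 θ K g j) :=
  fun h => not_liftInvariant_chiFix29OfRecord_zero_SU2 (F := F) K hK θ.ν hreg hreg' hε hε' (h 0 hK)

/-- **★★★ 17H's FIRST LOCATED N09 BINDER IS UNSATISFIABLE AT THE V17 DOOR IN PRINT's REGIME.**  For the windowed collared witness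
`θ = θ₁₅ᶜᶜᴹᵂ(j; γ; ε₀, ε₂₉; B₃, B₃′, a₀, a₁)` of `Node00/Record13NumericsOfThm1CCMW` (`θ.ν.εreg = a₀`, `θ.ε₂₉ = ε₂₉`) with `0 ≤ a₀`, `217·a₀ ≤ 2`,
`0 < ε₂₉ ≤ 2`, the hypothesis
`h09inv : ∀ P, ∀ j < P.K, LiftInvariant (chiβOfRecord₁₃ F 2 θ P.K (gOfRecord₁₃ F 2 θ P) j)` of
`Summits/…/BalabanUVNodesN24AtThm1CCMWDoorOfStepTokensSignFreeN09Located` (p575941, all five theorems) is FALSE (witness: run `⟨1, 0, 0⟩`, step `0`).  Hence those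
five theorems are VACUOUS in this regime (A6) — the cure is the junction's own located one: a COVARIANT minimiser selection behind `critCfgOfRecord` (FILE 1 §1)
AND (M1) re-typed on the solvable set ∕ a small-field domain (the junk corner lies outside every such domain).  The CRUX K1⁷ itself is untouched.
[cite: Balaban1987RG1, (2.9) p.266, (0.21) p.256, Thm 3 p.264 (typing convention); Balaban1985Averaging, Prop. 1 (51) p.26; Balaban1985Variational, Thm 1 p.279 (the radius `a₀`)] -/
theorem not_h09inv_theta13OfThm1CCMW (j : ℕ) (γ ε₀ ε₂₉ B₃ B₃' a₀ a₁ : ℝ) (ha₀ : 0 ≤ a₀) (ha₀' : 217 * a₀ ≤ 2) (hε : 0 < ε₂₉) (hε' : ε₂₉ ≤ 2) :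
    ¬ ∀ P : B12.RunParams, ∀ j' < P.K, LiftInvariant (chiβOfRecord₁₃ F 2 (theta13OfThm1CCMW F 2 j γ ε₀ ε₂₉ B₃ B₃' a₀ a₁) P.K
      (gOfRecord₁₃ F 2 (theta13OfThm1CCMW F 2 j γ ε₀ ε₂₉ B₃ B₃' a₀ a₁) P) j') := by
  intro h
  have h1 := h ⟨1, 0, 0⟩ 0 Nat.zero_lt_one
  exact not_liftInvariant_chiFix29OfRecord_zero_SU2 (F := F) 1 le_rfl (theta13OfThm1CCMW F 2 j γ ε₀ ε₂₉ B₃ B₃' a₀ a₁).ν ha₀ ha₀' hε hε' h1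

end SU2

end Summit.QuantumFields.YangMills.BalabanUVNodes.N09LiftInvariance29JunkWitness
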